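import Summits.Ventures.PercRepro.Night2ExcessMass

/-!
# PercRepro — the `(7, 5)` cell `(3, 0)` in the per-basis excess regime (night-2, gen 20)

For `9 ≤ n = |G| ≤ 15` the chord of `1/(m + 3)` over `2 ≤ m ≤ n − 5` bounds the excess of every covering
basis by `excessBound` (`2/5, 41/120, 8/27, 13/50, 38/165, 37/180, 12/65` at `n = 9 … 15`, against the crude
`ρ λ = 2/5`), and the target sum `genSum n 6 3 c′ (E/6) ≥ 1` holds with `m₁ = 3` (non-basis thin members miss
`≥ 3` points) at every `n`, and with no hypothesis at all (`m₁ = 2`) at `n ∈ {9, 14, 15}`.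
**`localShadowHall_three_zero_five_of_excess`**: (LI_G) at the cell for `9 ≤ |G| ≤ 15` given `m₁ = 3` only for
`10 ≤ |G| ≤ 13` — the residue of `Night2SevenFiveResidues` (`|G| ≤ 15 ∧ fat 0/3 ∧ fat 6/3 ∧ basis 2`) shrinks to
`10 ≤ |G| ≤ 13 ∧ fat 6/2 ∧ basis 2`.
-/

namespace PercRepro.Shadow

open Finset PerFlat ThmH

namespace DGenP

/-- The chord of `1/(m + 3)` over `2 ≤ m ≤ 4` (cell `(3, 0)`, `n = 9`). -/
theorem chord_three_zero_9 : ∀ m : ℕ, 2 ≤ m → m ≤ 4 →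
    1 / ((m : ℚ) + ((3 : ℕ) : ℚ)) ≤ (9 / 35 : ℚ) - (1 / 35 : ℚ) * (m : ℚ) := by
  intro m h1 h2
  interval_cases m <;> norm_num

/-- `excessBound = 2/5` at `(3, 0)`, `n = 9`. -/
theorem excessBound_three_zero_9 : excessBound 5 3 6 0 9 (9 / 35 : ℚ) (1 / 35 : ℚ) = (2 / 5 : ℚ) := by
  unfold excessBound capDG phiQ; norm_num

/-- The target sum of the cell `(3, 0)` at `n = 9` with `m₁ = 2`: `2/5 · C(9, 6) ≤ c′ A + T` with `A = 0`, `T = 46`. -/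
theorem sum_three_zero_9_m2 : 1 ≤ DGenP.genSum 9 6 3 (cPrimeDGP 5 3 6 0 2)
    (excessBound 5 3 6 0 9 (9 / 35 : ℚ) (1 / 35 : ℚ) / ((6 : ℕ) : ℚ)) := by
  have hc : cPrimeDGP 5 3 6 0 2 = (1 / 15 : ℚ) := by unfold cPrimeDGP capDG reqDGP phiQ; norm_num
  have hA : DGen.Aρt 9 6 3 = 0 := by decide
  have hT : DGen.Ttop 9 3 = 46 := by decide
  have hC : Nat.choose 9 6 = 84 := by decide
  rw [excessBound_three_zero_9, hc, DGenP.genSum_eq (by norm_num) (by norm_num) (by norm_num), hA, hT, hC]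
  norm_num

/-- The chord of `1/(m + 3)` over `2 ≤ m ≤ 5` (cell `(3, 0)`, `n = 10`). -/
theorem chord_three_zero_10 : ∀ m : ℕ, 2 ≤ m → m ≤ 5 →
    1 / ((m : ℚ) + ((3 : ℕ) : ℚ)) ≤ (1 / 4 : ℚ) - (1 / 40 : ℚ) * (m : ℚ) := by
  intro m h1 h2
  interval_cases m <;> norm_num

/-- `excessBound = 41/120` at `(3, 0)`, `n = 10`. -/
theorem excessBound_three_zero_10 : excessBound 5 3 6 0 10 (1 / 4 : ℚ) (1 / 40 : ℚ) = (41 / 120 : ℚ) := by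
  unfold excessBound capDG phiQ; norm_num

/-- The target sum of the cell `(3, 0)` at `n = 10` with `m₁ = 3`: `41/120 · C(10, 6) ≤ c′ A + T` with `A = 120`, `T = 56`. -/
theorem sum_three_zero_10_m3 : 1 ≤ DGenP.genSum 10 6 3 (cPrimeDGP 5 3 6 0 3)
    (excessBound 5 3 6 0 10 (1 / 4 : ℚ) (1 / 40 : ℚ) / ((6 : ℕ) : ℚ)) := by
  have hc : cPrimeDGP 5 3 6 0 3 = (2 / 9 : ℚ) := by unfold cPrimeDGP capDG reqDGP phiQ; norm_num
  have hA : DGen.Aρt 10 6 3 = 120 := by decide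
  have hT : DGen.Ttop 10 3 = 56 := by decide
  have hC : Nat.choose 10 6 = 210 := by decide
  rw [excessBound_three_zero_10, hc, DGenP.genSum_eq (by norm_num) (by norm_num) (by norm_num), hA, hT, hC]
  norm_num

/-- The chord of `1/(m + 3)` over `2 ≤ m ≤ 6` (cell `(3, 0)`, `n = 11`). -/
theorem chord_three_zero_11 : ∀ m : ℕ, 2 ≤ m → m ≤ 6 →
    1 / ((m : ℚ) + ((3 : ℕ) : ℚ)) ≤ (11 / 45 : ℚ) - (1 / 45 : ℚ) * (m : ℚ) := by
  intro m h1 h2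
  interval_cases m <;> norm_num

/-- `excessBound = 8/27` at `(3, 0)`, `n = 11`. -/
theorem excessBound_three_zero_11 : excessBound 5 3 6 0 11 (11 / 45 : ℚ) (1 / 45 : ℚ) = (8 / 27 : ℚ) := by
  unfold excessBound capDG phiQ; norm_num

/-- The target sum of the cell `(3, 0)` at `n = 11` with `m₁ = 3`: `8/27 · C(11, 6) ≤ c′ A + T` with `A = 495`, `T = 67`. -/
theorem sum_three_zero_11_m3 : 1 ≤ DGenP.genSum 11 6 3 (cPrimeDGP 5 3 6 0 3)
    (excessBound 5 3 6 0 11 (11 / 45 : ℚ) (1 / 45 : ℚ) / ((6 : ℕ) : ℚ)) := by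
  have hc : cPrimeDGP 5 3 6 0 3 = (2 / 9 : ℚ) := by unfold cPrimeDGP capDG reqDGP phiQ; norm_num
  have hA : DGen.Aρt 11 6 3 = 495 := by decide
  have hT : DGen.Ttop 11 3 = 67 := by decide
  have hC : Nat.choose 11 6 = 462 := by decide
  rw [excessBound_three_zero_11, hc, DGenP.genSum_eq (by norm_num) (by norm_num) (by norm_num), hA, hT, hC]
  norm_num

/-- The chord of `1/(m + 3)` over `2 ≤ m ≤ 7` (cell `(3, 0)`, `n = 12`). -/
theorem chord_three_zero_12 : ∀ m : ℕ, 2 ≤ m → m ≤ 7 →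
    1 / ((m : ℚ) + ((3 : ℕ) : ℚ)) ≤ (6 / 25 : ℚ) - (1 / 50 : ℚ) * (m : ℚ) := by
  intro m h1 h2
  interval_cases m <;> norm_num

/-- `excessBound = 13/50` at `(3, 0)`, `n = 12`. -/
theorem excessBound_three_zero_12 : excessBound 5 3 6 0 12 (6 / 25 : ℚ) (1 / 50 : ℚ) = (13 / 50 : ℚ) := by
  unfold excessBound capDG phiQ; norm_num

/-- The target sum of the cell `(3, 0)` at `n = 12` with `m₁ = 3`: `13/50 · C(12, 6) ≤ c′ A + T` with `A = 1507`, `T = 79`. -/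
theorem sum_three_zero_12_m3 : 1 ≤ DGenP.genSum 12 6 3 (cPrimeDGP 5 3 6 0 3)
    (excessBound 5 3 6 0 12 (6 / 25 : ℚ) (1 / 50 : ℚ) / ((6 : ℕ) : ℚ)) := by
  have hc : cPrimeDGP 5 3 6 0 3 = (2 / 9 : ℚ) := by unfold cPrimeDGP capDG reqDGP phiQ; norm_num
  have hA : DGen.Aρt 12 6 3 = 1507 := by decide
  have hT : DGen.Ttop 12 3 = 79 := by decide
  have hC : Nat.choose 12 6 = 924 := by decide
  rw [excessBound_three_zero_12, hc, DGenP.genSum_eq (by norm_num) (by norm_num) (by norm_num), hA, hT, hC]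
  norm_num

/-- The chord of `1/(m + 3)` over `2 ≤ m ≤ 8` (cell `(3, 0)`, `n = 13`). -/
theorem chord_three_zero_13 : ∀ m : ℕ, 2 ≤ m → m ≤ 8 →
    1 / ((m : ℚ) + ((3 : ℕ) : ℚ)) ≤ (13 / 55 : ℚ) - (1 / 55 : ℚ) * (m : ℚ) := by
  intro m h1 h2
  interval_cases m <;> norm_num

/-- `excessBound = 38/165` at `(3, 0)`, `n = 13`. -/
theorem excessBound_three_zero_13 : excessBound 5 3 6 0 13 (13 / 55 : ℚ) (1 / 55 : ℚ) = (38 / 165 : ℚ) := by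
  unfold excessBound capDG phiQ; norm_num

/-- The target sum of the cell `(3, 0)` at `n = 13` with `m₁ = 3`: `38/165 · C(13, 6) ≤ c′ A + T` with `A = 4004`, `T = 92`. -/
theorem sum_three_zero_13_m3 : 1 ≤ DGenP.genSum 13 6 3 (cPrimeDGP 5 3 6 0 3)
    (excessBound 5 3 6 0 13 (13 / 55 : ℚ) (1 / 55 : ℚ) / ((6 : ℕ) : ℚ)) := by
  have hc : cPrimeDGP 5 3 6 0 3 = (2 / 9 : ℚ) := by unfold cPrimeDGP capDG reqDGP phiQ; norm_num
  have hA : DGen.Aρt 13 6 3 = 4004 := by decide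
  have hT : DGen.Ttop 13 3 = 92 := by decide
  have hC : Nat.choose 13 6 = 1716 := by decide
  rw [excessBound_three_zero_13, hc, DGenP.genSum_eq (by norm_num) (by norm_num) (by norm_num), hA, hT, hC]
  norm_num

/-- The chord of `1/(m + 3)` over `2 ≤ m ≤ 9` (cell `(3, 0)`, `n = 14`). -/
theorem chord_three_zero_14 : ∀ m : ℕ, 2 ≤ m → m ≤ 9 →
    1 / ((m : ℚ) + ((3 : ℕ) : ℚ)) ≤ (7 / 30 : ℚ) - (1 / 60 : ℚ) * (m : ℚ) := by
  intro m h1 h2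
  interval_cases m <;> norm_num

/-- `excessBound = 37/180` at `(3, 0)`, `n = 14`. -/
theorem excessBound_three_zero_14 : excessBound 5 3 6 0 14 (7 / 30 : ℚ) (1 / 60 : ℚ) = (37 / 180 : ℚ) := by
  unfold excessBound capDG phiQ; norm_num

/-- The target sum of the cell `(3, 0)` at `n = 14` with `m₁ = 2`: `37/180 · C(14, 6) ≤ c′ A + T` with `A = 9802`, `T = 106`. -/
theorem sum_three_zero_14_m2 : 1 ≤ DGenP.genSum 14 6 3 (cPrimeDGP 5 3 6 0 2)
    (excessBound 5 3 6 0 14 (7 / 30 : ℚ) (1 / 60 : ℚ) / ((6 : ℕ) : ℚ)) := by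
  have hc : cPrimeDGP 5 3 6 0 2 = (1 / 15 : ℚ) := by unfold cPrimeDGP capDG reqDGP phiQ; norm_num
  have hA : DGen.Aρt 14 6 3 = 9802 := by decide
  have hT : DGen.Ttop 14 3 = 106 := by decide
  have hC : Nat.choose 14 6 = 3003 := by decide
  rw [excessBound_three_zero_14, hc, DGenP.genSum_eq (by norm_num) (by norm_num) (by norm_num), hA, hT, hC]
  norm_num

/-- The chord of `1/(m + 3)` over `2 ≤ m ≤ 10` (cell `(3, 0)`, `n = 15`). -/
theorem chord_three_zero_15 : ∀ m : ℕ, 2 ≤ m → m ≤ 10 →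
    1 / ((m : ℚ) + ((3 : ℕ) : ℚ)) ≤ (3 / 13 : ℚ) - (1 / 65 : ℚ) * (m : ℚ) := by
  intro m h1 h2
  interval_cases m <;> norm_num

/-- `excessBound = 12/65` at `(3, 0)`, `n = 15`. -/
theorem excessBound_three_zero_15 : excessBound 5 3 6 0 15 (3 / 13 : ℚ) (1 / 65 : ℚ) = (12 / 65 : ℚ) := by
  unfold excessBound capDG phiQ; norm_num

/-- The target sum of the cell `(3, 0)` at `n = 15` with `m₁ = 2`: `12/65 · C(15, 6) ≤ c′ A + T` with `A = 22698`, `T = 121`. -/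
theorem sum_three_zero_15_m2 : 1 ≤ DGenP.genSum 15 6 3 (cPrimeDGP 5 3 6 0 2)
    (excessBound 5 3 6 0 15 (3 / 13 : ℚ) (1 / 65 : ℚ) / ((6 : ℕ) : ℚ)) := by
  have hc : cPrimeDGP 5 3 6 0 2 = (1 / 15 : ℚ) := by unfold cPrimeDGP capDG reqDGP phiQ; norm_num
  have hA : DGen.Aρt 15 6 3 = 22698 := by decide
  have hT : DGen.Ttop 15 3 = 121 := by decide
  have hC : Nat.choose 15 6 = 5005 := by decide
  rw [excessBound_three_zero_15, hc, DGenP.genSum_eq (by norm_num) (by norm_num) (by norm_num), hA, hT, hC]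
  norm_num

end DGenP

variable {α : Type*} [DecidableEq α] {M : Matroid α} [M.Finite]

open DGenP in
open scoped Classical in
/-- **THE `(7, 5)` CELL `(3, 0)` IN THE PER-BASIS EXCESS REGIME**, `9 ≤ |G| ≤ 15`: every thin member with
`|B| ≥ 6` misses at least `3` points when `10 ≤ |G| ≤ 13` (no hypothesis at `|G| ∈ {9, 14, 15}`). -/
theorem localShadowHall_three_zero_five_of_excess {G : Finset α} (hG : G ∈ flatsQ M (5 + 1))
    (hd : (gr M \ G).card = 3) (hk : kColoops M G = 0)
    (hs : ∀ e ∈ gr M, ∀ f ∈ gr M, e ≠ f → rkN M {e, f} = 2) (hl : ∀ e ∈ gr M, M.Indep {e})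
    (hn1 : 9 ≤ G.card) (hn2 : G.card ≤ 15)
    (hm₁ : 10 ≤ G.card → G.card ≤ 13 →
      ∀ B ∈ thinMembers M 5 G, 6 ≤ (B \ coloops M G).card → 3 ≤ (G \ clF M B).card) :
    LocalShadowHall M 5 G := by
  have hk' : kColoops M G + 6 = 5 + 1 := by omega
  have hm2 : ∀ B ∈ thinMembers M 5 G, 6 ≤ (B \ coloops M G).card → 2 ≤ (G \ clF M B).card :=
    fun B hB _ => two_le_card_sdiff_of_not_lay0 hG (by omega) (mem_thinMembers.1 hB).1 (mem_thinMembers.1 hB).2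
  have hc2 : 0 ≤ cPrimeDGP 5 3 6 (kColoops M G) 2 := by rw [hk]; unfold cPrimeDGP capDG reqDGP phiQ; norm_num
  have hc3 : 0 ≤ cPrimeDGP 5 3 6 (kColoops M G) 3 := by rw [hk]; unfold cPrimeDGP capDG reqDGP phiQ; norm_num
  obtain ⟨n, hn⟩ : ∃ n, G.card - kColoops M G = n := ⟨_, rfl⟩
  have hn1' : 9 ≤ n := by omega
  have hn2' : n ≤ 15 := by omega
  interval_cases n
  · exact localShadowHall_excess_of_sum (d := 3) (ρ := 6) (m₁ := 2) hG hd (by norm_num) hk' (by norm_num)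
      (by omega) hs hl hc2 hm2 (a := (9 / 35 : ℚ)) (b := (1 / 35 : ℚ)) (by norm_num)
      (by rw [hn]; intro m h1 h2; exact chord_three_zero_9 m h1 (by omega))
      (by rw [hn, hk, excessBound_three_zero_9]; norm_num) (by rw [hn, hk]; exact sum_three_zero_9_m2)
  · exact localShadowHall_excess_of_sum (d := 3) (ρ := 6) (m₁ := 3) hG hd (by norm_num) hk' (by norm_num)
      (by omega) hs hl hc3 (hm₁ (by omega) (by omega)) (a := (1 / 4 : ℚ)) (b := (1 / 40 : ℚ)) (by norm_num)
      (by rw [hn]; intro m h1 h2; exact chord_three_zero_10 m h1 (by omega))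
      (by rw [hn, hk, excessBound_three_zero_10]; norm_num) (by rw [hn, hk]; exact sum_three_zero_10_m3)
  · exact localShadowHall_excess_of_sum (d := 3) (ρ := 6) (m₁ := 3) hG hd (by norm_num) hk' (by norm_num)
      (by omega) hs hl hc3 (hm₁ (by omega) (by omega)) (a := (11 / 45 : ℚ)) (b := (1 / 45 : ℚ)) (by norm_num)
      (by rw [hn]; intro m h1 h2; exact chord_three_zero_11 m h1 (by omega))
      (by rw [hn, hk, excessBound_three_zero_11]; norm_num) (by rw [hn, hk]; exact sum_three_zero_11_m3)
  · exact localShadowHall_excess_of_sum (d := 3) (ρ := 6) (m₁ := 3) hG hd (by norm_num) hk' (by norm_num)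
      (by omega) hs hl hc3 (hm₁ (by omega) (by omega)) (a := (6 / 25 : ℚ)) (b := (1 / 50 : ℚ)) (by norm_num)
      (by rw [hn]; intro m h1 h2; exact chord_three_zero_12 m h1 (by omega))
      (by rw [hn, hk, excessBound_three_zero_12]; norm_num) (by rw [hn, hk]; exact sum_three_zero_12_m3)
  · exact localShadowHall_excess_of_sum (d := 3) (ρ := 6) (m₁ := 3) hG hd (by norm_num) hk' (by norm_num)
      (by omega) hs hl hc3 (hm₁ (by omega) (by omega)) (a := (13 / 55 : ℚ)) (b := (1 / 55 : ℚ)) (by norm_num)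
      (by rw [hn]; intro m h1 h2; exact chord_three_zero_13 m h1 (by omega))
      (by rw [hn, hk, excessBound_three_zero_13]; norm_num) (by rw [hn, hk]; exact sum_three_zero_13_m3)
  · exact localShadowHall_excess_of_sum (d := 3) (ρ := 6) (m₁ := 2) hG hd (by norm_num) hk' (by norm_num)
      (by omega) hs hl hc2 hm2 (a := (7 / 30 : ℚ)) (b := (1 / 60 : ℚ)) (by norm_num)
      (by rw [hn]; intro m h1 h2; exact chord_three_zero_14 m h1 (by omega))
      (by rw [hn, hk, excessBound_three_zero_14]; norm_num) (by rw [hn, hk]; exact sum_three_zero_14_m2)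
  · exact localShadowHall_excess_of_sum (d := 3) (ρ := 6) (m₁ := 2) hG hd (by norm_num) hk' (by norm_num)
      (by omega) hs hl hc2 hm2 (a := (3 / 13 : ℚ)) (b := (1 / 65 : ℚ)) (by norm_num)
      (by rw [hn]; intro m h1 h2; exact chord_three_zero_15 m h1 (by omega))
      (by rw [hn, hk, excessBound_three_zero_15]; norm_num) (by rw [hn, hk]; exact sum_three_zero_15_m2)

end PercRepro.Shadow
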